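import Literature.Analysis.PDE.FreeFlowSlabSmooth
import Literature.Analysis.PDE.SobolevEnergy
import Mathlib.MeasureTheory.Measure.Lebesgue.EqHaar
import Mathlib.MeasureTheory.Group.LIntegral
import Mathlib.Analysis.InnerProductSpace.Adjoint
import HarnessLib

/-!
# Sobolev energies under linear and affine changes of variables (topic `Analysis/PDE`)

Analytic layer of the programme to prove short-time existence for quasilinear strictly
parabolic systems on a closed manifold (hypothesis `hQL` of
`Literature.Geometry.Riemannian.ricciFlow_shortTime_existence_of_quasilinear`). In the fine
parametrix of that programme all patches live in ONE Euclidean space and differ by AFFINE maps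
(frames adapted to the principal symbol at the patch centres); the top-order error of a patch is
transported to its neighbours, and the transport constant at top order must be controlled by a
power of the operator norm of the linear part only (no derivative of cut-offs, no Faà di Bruno
constants). This file proves exactly this:

* `sobolevEnergy_eq_sum_words` — the recursive energy is the plain sum over all frame words,
  `E_j(f) = Σ_{i ≤ j} Σ_{β ∈ [n]^i} ∫ ‖∂_β f‖²` (no multiplicities);
* `sum_norm_sq_comp_le_mul` / `sum_norm_sq_multilinear_comp_le` — Hilbert–Schmidt sums over
  basis tuples under a linear map in the arguments: `Σ_β ‖T(Mb_β)‖² ≤ ‖M‖^{2i} Σ_β ‖T(b_β)‖²`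
  (adjoints and Parseval, slot by slot);
* `sobolevEnergy_comp_linear_le` — `E_j(f ∘ M) ≤ max(1, ‖M‖²)^j |det M|⁻¹ E_j(f)` for an
  invertible linear `M` (the above and the behaviour of the Haar measure under linear maps);
* `sobolevEnergy_comp_add_right` — translation invariance `E_j(f(· + v)) = E_j(f)`.

Everything is proved; no named fact and no `sorry` is introduced.

## References

* R. A. Adams, *Sobolev Spaces*, Academic Press 1975, Thm. 3.35 (transformation of
  coordinates; here the linear case with explicit constant). [Adams1975]
-/

noncomputable section

open MeasureTheory Set Function Filter Topology
open scoped ENNReal ContDiff RealInnerProductSpace InnerProductSpace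

namespace Literature.Analysis.PDE

open Literature.Analysis.FunctionSpaces

variable {E : Type*} [NormedAddCommGroup E] [InnerProductSpace ℝ E] [FiniteDimensional ℝ E]
  [MeasurableSpace E] [BorelSpace E]
variable {F : Type*} [NormedAddCommGroup F]

/-! ### The energy as a plain sum over frame words -/

section Words

variable [NormedSpace ℝ F]

/-- **The recursive energy is the sum over all frame words** of length `≤ j` of the squared
`L²` norms of the word derivatives, each word counted once. [cite: Adams1975, ¶3.1] -/
theorem sobolevEnergy_eq_sum_words (j : ℕ) : ∀ f : E → F, sobolevEnergy j f =
      ∑ i ∈ Finset.range (j + 1), ∑ β : Fin i → Fin (Module.finrank ℝ E),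
        ∫⁻ x, ‖iterDirDeriv (List.ofFn fun l ↦ stdOrthonormalBasis ℝ E (β l)) f x‖ₑ ^ 2 := by
  induction j with
  | zero =>
    intro f
    simp [sobolevEnergy_zero_left]
  | succ j ih =>
    intro f
    set b := stdOrthonormalBasis ℝ E
    rw [sobolevEnergy_succ, Finset.sum_range_succ' _ (j + 1)]
    -- the order-zero word
    have h0 : (∑ β : Fin 0 → Fin (Module.finrank ℝ E),
        ∫⁻ x, ‖iterDirDeriv (List.ofFn fun l ↦ b (β l)) f x‖ₑ ^ 2) = ∫⁻ x, ‖f x‖ₑ ^ 2 := by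
      simp
    rw [h0, add_comm]
    congr 1
    -- words of length `i + 1` split as `(β', k)` with `k` innermost
    simp_rw [ih]
    rw [Finset.sum_comm]
    refine Finset.sum_congr rfl fun i _ ↦ ?_
    rw [← (Fintype.sum_equiv (Fin.snocEquiv fun _ ↦ Fin (Module.finrank ℝ E)) _
      (fun γ ↦ ∫⁻ x, ‖iterDirDeriv (List.ofFn fun l ↦ b (γ l)) f x‖ₑ ^ 2) (fun _ ↦ rfl)),
      Fintype.sum_prod_type]
    refine Finset.sum_congr rfl fun k _ ↦ Finset.sum_congr rfl fun β' _ ↦ ?_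
    simp only [Fin.snocEquiv, Equiv.coe_fn_mk]
    have hlist : (List.ofFn fun l ↦ b ((Fin.snoc β' k : Fin (i + 1) → Fin (Module.finrank ℝ E)) l)) =
        List.ofFn (fun l ↦ b (β' l)) ++ [b k] := by
      rw [List.ofFn_succ', List.concat_eq_append]
      simp [Fin.snoc_castSucc, Fin.snoc_last]
    rw [hlist, iterDirDeriv_append_singleton]

end Words

/-! ### Hilbert–Schmidt sums under a linear map in the arguments -/

section HS

variable [InnerProductSpace ℝ F] [FiniteDimensional ℝ F]

omit [MeasurableSpace E] [BorelSpace E] in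
/-- **One slot**: for `L : E →L F` and `M : E →L E`,
`Σ_k ‖L(M b_k)‖² ≤ ‖M‖² Σ_k ‖L b_k‖²` (both sides are Hilbert–Schmidt sums; adjoints and
Parseval). [folklore] -/
theorem sum_norm_sq_comp_le_mul (L : E →L[ℝ] F) (M : E →L[ℝ] E) :
    ∑ k, ‖L (M (stdOrthonormalBasis ℝ E k))‖ ^ 2 ≤
      ‖M‖ ^ 2 * ∑ k, ‖L (stdOrthonormalBasis ℝ E k)‖ ^ 2 := by
  haveI : CompleteSpace E := FiniteDimensional.complete ℝ E
  haveI : CompleteSpace F := FiniteDimensional.complete ℝ F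
  set b := stdOrthonormalBasis ℝ E
  set u := stdOrthonormalBasis ℝ F
  -- `Σ_k ‖A b_k‖² = Σ_m ‖A† u_m‖²` for every `A : E →L F`
  have hHS : ∀ A : E →L[ℝ] F, ∑ k, ‖A (b k)‖ ^ 2 = ∑ m, ‖(ContinuousLinearMap.adjoint A) (u m)‖ ^ 2 := by
    intro A
    calc ∑ k, ‖A (b k)‖ ^ 2 = ∑ k, ∑ m, ⟪u m, A (b k)⟫ ^ 2 := by
          refine Finset.sum_congr rfl fun k _ ↦ (u.sum_sq_inner_right (A (b k))).symm
      _ = ∑ m, ∑ k, ⟪(ContinuousLinearMap.adjoint A) (u m), b k⟫ ^ 2 := by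
          rw [Finset.sum_comm]
          refine Finset.sum_congr rfl fun m _ ↦ Finset.sum_congr rfl fun k _ ↦ ?_
          rw [ContinuousLinearMap.adjoint_inner_left]
      _ = ∑ m, ‖(ContinuousLinearMap.adjoint A) (u m)‖ ^ 2 :=
          Finset.sum_congr rfl fun m _ ↦ b.sum_sq_inner_left _
  rw [show (∑ k, ‖L (M (b k))‖ ^ 2) = ∑ k, ‖(L.comp M) (b k)‖ ^ 2 from rfl, hHS (L.comp M), hHS L,
    Finset.mul_sum]
  refine Finset.sum_le_sum fun m _ ↦ ?_
  rw [ContinuousLinearMap.adjoint_comp, ContinuousLinearMap.comp_apply]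
  calc ‖(ContinuousLinearMap.adjoint M) ((ContinuousLinearMap.adjoint L) (u m))‖ ^ 2
      ≤ (‖ContinuousLinearMap.adjoint M‖ * ‖(ContinuousLinearMap.adjoint L) (u m)‖) ^ 2 :=
        pow_le_pow_left₀ (norm_nonneg _) (ContinuousLinearMap.le_opNorm _ _) 2
    _ = ‖M‖ ^ 2 * ‖(ContinuousLinearMap.adjoint L) (u m)‖ ^ 2 := by
        rw [mul_pow, ContinuousLinearMap.adjoint.norm_map]

omit [MeasurableSpace E] [BorelSpace E] in
/-- Freezing a tuple behind a `Fin.cons` commutes with applying a map entrywise. [folklore] -/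
theorem comp_cons_eq {α β : Type*} {i : ℕ} (h : α → β) (a : α) (t : Fin i → α) :
    (fun l ↦ h ((Fin.cons a t : Fin (i + 1) → α) l)) = Fin.cons (h a) fun l ↦ h (t l) := by
  funext l
  refine Fin.cases ?_ (fun l' ↦ ?_) l
  · simp
  · simp

omit [MeasurableSpace E] [BorelSpace E] in
/-- **All slots**: for a continuous multilinear map `T` in `i` arguments and `M : E →L E`,
`Σ_β ‖T(M b_{β₁}, …, M b_{βᵢ})‖² ≤ (‖M‖²)^i Σ_β ‖T(b_{β₁}, …, b_{βᵢ})‖²`. [folklore] -/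
theorem sum_norm_sq_multilinear_comp_le (i : ℕ) :
    ∀ (T : ContinuousMultilinearMap ℝ (fun _ : Fin i ↦ E) F) (M : E →L[ℝ] E),
      ∑ β : Fin i → Fin (Module.finrank ℝ E), ‖T fun l ↦ M (stdOrthonormalBasis ℝ E (β l))‖ ^ 2 ≤
        (‖M‖ ^ 2) ^ i *
          ∑ β : Fin i → Fin (Module.finrank ℝ E), ‖T fun l ↦ stdOrthonormalBasis ℝ E (β l)‖ ^ 2 := by
  induction i with
  | zero =>
    intro T M
    simp only [pow_zero, one_mul]
    refine le_of_eq (Fintype.sum_congr _ _ fun β ↦ ?_)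
    have h : (fun l : Fin 0 ↦ M (stdOrthonormalBasis ℝ E (β l))) =
        fun l ↦ stdOrthonormalBasis ℝ E (β l) := funext fun l ↦ Fin.elim0 l
    rw [h]
  | succ i ih =>
    intro T M
    -- split the words as `cons k β'`
    have hsplit : ∀ g : (Fin (i + 1) → Fin (Module.finrank ℝ E)) → ℝ,
        ∑ β, g β = ∑ k : Fin (Module.finrank ℝ E), ∑ β' : Fin i → Fin (Module.finrank ℝ E), g (Fin.cons k β') := by
      intro g
      rw [← Fintype.sum_prod_type']
      exact (Fintype.sum_equiv (Fin.consEquiv fun _ ↦ Fin (Module.finrank ℝ E)) (fun p ↦ g (Fin.cons p.1 p.2)) g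
        fun p ↦ rfl).symm
    rw [hsplit, hsplit]
    have e1 : ∀ (k : Fin (Module.finrank ℝ E)) (β' : Fin i → Fin (Module.finrank ℝ E)),
        (fun l ↦ M ((stdOrthonormalBasis ℝ E) ((Fin.cons k β' : Fin (i + 1) → Fin (Module.finrank ℝ E)) l))) =
          Fin.cons (M ((stdOrthonormalBasis ℝ E) k)) fun l ↦ M ((stdOrthonormalBasis ℝ E) (β' l)) := fun k β' ↦ comp_cons_eq (fun x ↦ M ((stdOrthonormalBasis ℝ E) x)) k β'
    have e2 : ∀ (k : Fin (Module.finrank ℝ E)) (β' : Fin i → Fin (Module.finrank ℝ E)),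
        (fun l ↦ (stdOrthonormalBasis ℝ E) ((Fin.cons k β' : Fin (i + 1) → Fin (Module.finrank ℝ E)) l)) =
          Fin.cons ((stdOrthonormalBasis ℝ E) k) fun l ↦ (stdOrthonormalBasis ℝ E) (β' l) := fun k β' ↦ comp_cons_eq (fun x ↦ (stdOrthonormalBasis ℝ E) x) k β'
    simp_rw [e1, e2]
    -- Step 1: the first slot, for each frozen tail
    have h1 : ∀ β' : Fin i → Fin (Module.finrank ℝ E),
        ∑ k, ‖T (Fin.cons (M ((stdOrthonormalBasis ℝ E) k)) fun l ↦ M ((stdOrthonormalBasis ℝ E) (β' l)))‖ ^ 2 ≤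
          ‖M‖ ^ 2 * ∑ k, ‖T (Fin.cons ((stdOrthonormalBasis ℝ E) k) fun l ↦ M ((stdOrthonormalBasis ℝ E) (β' l)))‖ ^ 2 := by
      intro β'
      set w : Fin (i + 1) → E := Fin.cons 0 fun l ↦ M ((stdOrthonormalBasis ℝ E) (β' l))
      set L : E →L[ℝ] F := T.toContinuousLinearMap w 0
      have hL : ∀ x, L x = T (Fin.cons x fun l ↦ M ((stdOrthonormalBasis ℝ E) (β' l))) := by
        intro x
        simp only [L, w, ContinuousMultilinearMap.toContinuousLinearMap_apply]
        congr 1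
        exact Fin.update_cons_zero _ _ _
      have h := sum_norm_sq_comp_le_mul L M
      simp only [hL] at h
      exact h
    -- Step 2: the remaining slots, for each frozen first entry (induction hypothesis)
    have h2 : ∀ k : Fin (Module.finrank ℝ E),
        ∑ β' : Fin i → Fin (Module.finrank ℝ E), ‖T (Fin.cons ((stdOrthonormalBasis ℝ E) k) fun l ↦ M ((stdOrthonormalBasis ℝ E) (β' l)))‖ ^ 2 ≤
          (‖M‖ ^ 2) ^ i * ∑ β' : Fin i → Fin (Module.finrank ℝ E), ‖T (Fin.cons ((stdOrthonormalBasis ℝ E) k) fun l ↦ (stdOrthonormalBasis ℝ E) (β' l))‖ ^ 2 := by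
      intro k
      have h := ih (T.curryLeft ((stdOrthonormalBasis ℝ E) k)) M
      simp only [ContinuousMultilinearMap.curryLeft_apply] at h
      exact h
    calc ∑ k, ∑ β' : Fin i → Fin (Module.finrank ℝ E), ‖T (Fin.cons (M ((stdOrthonormalBasis ℝ E) k)) fun l ↦ M ((stdOrthonormalBasis ℝ E) (β' l)))‖ ^ 2
        = ∑ β' : Fin i → Fin (Module.finrank ℝ E), ∑ k, ‖T (Fin.cons (M ((stdOrthonormalBasis ℝ E) k)) fun l ↦ M ((stdOrthonormalBasis ℝ E) (β' l)))‖ ^ 2 :=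
          Finset.sum_comm
      _ ≤ ∑ β' : Fin i → Fin (Module.finrank ℝ E), ‖M‖ ^ 2 * ∑ k, ‖T (Fin.cons ((stdOrthonormalBasis ℝ E) k) fun l ↦ M ((stdOrthonormalBasis ℝ E) (β' l)))‖ ^ 2 :=
          Finset.sum_le_sum fun β' _ ↦ h1 β'
      _ = ‖M‖ ^ 2 * ∑ k, ∑ β' : Fin i → Fin (Module.finrank ℝ E), ‖T (Fin.cons ((stdOrthonormalBasis ℝ E) k) fun l ↦ M ((stdOrthonormalBasis ℝ E) (β' l)))‖ ^ 2 := by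
          rw [← Finset.mul_sum, Finset.sum_comm]
      _ ≤ ‖M‖ ^ 2 * ∑ k, ((‖M‖ ^ 2) ^ i *
            ∑ β' : Fin i → Fin (Module.finrank ℝ E), ‖T (Fin.cons ((stdOrthonormalBasis ℝ E) k) fun l ↦ (stdOrthonormalBasis ℝ E) (β' l))‖ ^ 2) :=
          mul_le_mul_of_nonneg_left (Finset.sum_le_sum fun k _ ↦ h2 k) (sq_nonneg _)
      _ = (‖M‖ ^ 2) ^ (i + 1) * ∑ k, ∑ β' : Fin i → Fin (Module.finrank ℝ E),
            ‖T (Fin.cons ((stdOrthonormalBasis ℝ E) k) fun l ↦ (stdOrthonormalBasis ℝ E) (β' l))‖ ^ 2 := by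
          rw [← Finset.mul_sum]
          ring

end HS

/-! ### Energies under linear and affine maps -/

section Linear

variable [InnerProductSpace ℝ F] [FiniteDimensional ℝ F]

/-- The integral of a nonnegative function composed with an invertible linear map.
[folklore] -/
theorem lintegral_comp_linear_eq (M : E →L[ℝ] E) (hM : LinearMap.det (M : E →ₗ[ℝ] E) ≠ 0)
    {g : E → ℝ≥0∞} (hg : Measurable g) :
    ∫⁻ x, g (M x) = ENNReal.ofReal |(LinearMap.det (M : E →ₗ[ℝ] E))⁻¹| * ∫⁻ y, g y := by
  have h1 : ∫⁻ x, g (M x) = ∫⁻ y, g y ∂(Measure.map M volume) :=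
    (lintegral_map hg M.continuous.measurable).symm
  rw [h1]
  have h2 : Measure.map (M : E → E) volume = Measure.map (M : E →ₗ[ℝ] E) (volume : Measure E) := rfl
  rw [h2, Measure.map_linearMap_addHaar_eq_smul_addHaar _ hM, lintegral_smul_measure]
  rfl

/-- **Energies under an invertible linear map**:
`E_j(f ∘ M) ≤ max(1, ‖M‖²)^j |det M|⁻¹ E_j(f)` for smooth `f`. [cite: Adams1975, Thm. 3.35] -/
theorem sobolevEnergy_comp_linear_le (M : E →L[ℝ] E) (hM : LinearMap.det (M : E →ₗ[ℝ] E) ≠ 0)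
    (j : ℕ) {f : E → F} (hf : ContDiff ℝ ∞ f) :
    sobolevEnergy j (fun x ↦ f (M x)) ≤
      ENNReal.ofReal (max 1 (‖M‖ ^ 2) ^ j * |(LinearMap.det (M : E →ₗ[ℝ] E))⁻¹|) *
        sobolevEnergy j f := by
  set d : ℝ := |(LinearMap.det (M : E →ₗ[ℝ] E))⁻¹| with hd
  have hfM : ContDiff ℝ ∞ fun x ↦ f (M x) := hf.comp M.contDiff
  rw [sobolevEnergy_eq_sum_words j (fun x ↦ f (M x)), sobolevEnergy_eq_sum_words j f,
    Finset.mul_sum]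
  refine Finset.sum_le_sum fun i hi ↦ ?_
  have hij : i ≤ j := Nat.lt_succ_iff.1 (Finset.mem_range.1 hi)
  -- the word derivatives of `f ∘ M` in terms of those of `f`
  have hpt : ∀ x, ∑ β : Fin i → Fin (Module.finrank ℝ E),
      ‖iterDirDeriv (List.ofFn fun l ↦ (stdOrthonormalBasis ℝ E) (β l)) (fun x ↦ f (M x)) x‖ₑ ^ 2 ≤
        ENNReal.ofReal ((‖M‖ ^ 2) ^ i) *
          ∑ β : Fin i → Fin (Module.finrank ℝ E), ‖iterDirDeriv (List.ofFn fun l ↦ (stdOrthonormalBasis ℝ E) (β l)) f (M x)‖ₑ ^ 2 := by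
    intro x
    have hcomp : ∀ β : Fin i → Fin (Module.finrank ℝ E),
        iterDirDeriv (List.ofFn fun l ↦ (stdOrthonormalBasis ℝ E) (β l)) (fun x ↦ f (M x)) x =
          iteratedFDeriv ℝ i f (M x) fun l ↦ M ((stdOrthonormalBasis ℝ E) (β l)) := by
      intro β
      rw [← iteratedFDeriv_apply_eq_iterDirDeriv_ofFn hfM x]
      have h := ContinuousLinearMap.iteratedFDeriv_comp_right M hf x (i := i) (by exact_mod_cast le_top)
      rw [show (fun x ↦ f (M x)) = f ∘ M from rfl, h]
      rfl
    have hf' : ∀ β : Fin i → Fin (Module.finrank ℝ E), iterDirDeriv (List.ofFn fun l ↦ (stdOrthonormalBasis ℝ E) (β l)) f (M x) =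
        iteratedFDeriv ℝ i f (M x) fun l ↦ (stdOrthonormalBasis ℝ E) (β l) := fun β ↦
      (iteratedFDeriv_apply_eq_iterDirDeriv_ofFn hf (M x) _).symm
    simp_rw [hcomp, hf']
    have hreal := sum_norm_sq_multilinear_comp_le i (iteratedFDeriv ℝ i f (M x)) M
    -- move to `ℝ≥0∞`
    have hl : ∑ β : Fin i → Fin (Module.finrank ℝ E), ‖iteratedFDeriv ℝ i f (M x) fun l ↦ M ((stdOrthonormalBasis ℝ E) (β l))‖ₑ ^ 2 =
        ENNReal.ofReal (∑ β : Fin i → Fin (Module.finrank ℝ E), ‖iteratedFDeriv ℝ i f (M x) fun l ↦ M ((stdOrthonormalBasis ℝ E) (β l))‖ ^ 2) := by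
      rw [ENNReal.ofReal_sum_of_nonneg fun _ _ ↦ sq_nonneg _]
      refine Finset.sum_congr rfl fun β _ ↦ ?_
      rw [← ofReal_norm, ENNReal.ofReal_pow (norm_nonneg _)]
    have hr : ∑ β : Fin i → Fin (Module.finrank ℝ E), ‖iteratedFDeriv ℝ i f (M x) fun l ↦ (stdOrthonormalBasis ℝ E) (β l)‖ₑ ^ 2 =
        ENNReal.ofReal (∑ β : Fin i → Fin (Module.finrank ℝ E), ‖iteratedFDeriv ℝ i f (M x) fun l ↦ (stdOrthonormalBasis ℝ E) (β l)‖ ^ 2) := by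
      rw [ENNReal.ofReal_sum_of_nonneg fun _ _ ↦ sq_nonneg _]
      refine Finset.sum_congr rfl fun β _ ↦ ?_
      rw [← ofReal_norm, ENNReal.ofReal_pow (norm_nonneg _)]
    rw [hl, hr, ← ENNReal.ofReal_mul (by positivity)]
    exact ENNReal.ofReal_le_ofReal hreal
  -- measurability of the slice functional of `f`
  have hmeas : ∀ β : Fin i → Fin (Module.finrank ℝ E),
      Measurable fun y ↦ ‖iterDirDeriv (List.ofFn fun l ↦ (stdOrthonormalBasis ℝ E) (β l)) f y‖ₑ ^ 2 := fun β ↦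
    (continuous_enorm.comp (contDiff_iterDirDeriv hf _).continuous).measurable.pow_const 2
  have hmeasS : Measurable fun y ↦ ∑ β : Fin i → Fin (Module.finrank ℝ E),
      ‖iterDirDeriv (List.ofFn fun l ↦ (stdOrthonormalBasis ℝ E) (β l)) f y‖ₑ ^ 2 :=
    Finset.measurable_sum _ fun β _ ↦ hmeas β
  have hmeasM : ∀ β : Fin i → Fin (Module.finrank ℝ E),
      Measurable fun x ↦ ‖iterDirDeriv (List.ofFn fun l ↦ (stdOrthonormalBasis ℝ E) (β l)) (fun x ↦ f (M x)) x‖ₑ ^ 2 :=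
    fun β ↦ (continuous_enorm.comp (contDiff_iterDirDeriv hfM _).continuous).measurable.pow_const 2
  calc ∑ β : Fin i → Fin (Module.finrank ℝ E), ∫⁻ x, ‖iterDirDeriv (List.ofFn fun l ↦ (stdOrthonormalBasis ℝ E) (β l)) (fun x ↦ f (M x)) x‖ₑ ^ 2
      = ∫⁻ x, ∑ β : Fin i → Fin (Module.finrank ℝ E),
          ‖iterDirDeriv (List.ofFn fun l ↦ (stdOrthonormalBasis ℝ E) (β l)) (fun x ↦ f (M x)) x‖ₑ ^ 2 :=
        (lintegral_finsetSum _ fun β _ ↦ hmeasM β).symm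
    _ ≤ ∫⁻ x, ENNReal.ofReal ((‖M‖ ^ 2) ^ i) *
          ∑ β : Fin i → Fin (Module.finrank ℝ E), ‖iterDirDeriv (List.ofFn fun l ↦ (stdOrthonormalBasis ℝ E) (β l)) f (M x)‖ₑ ^ 2 :=
        lintegral_mono hpt
    _ = ENNReal.ofReal ((‖M‖ ^ 2) ^ i) * (ENNReal.ofReal d *
          ∫⁻ y, ∑ β : Fin i → Fin (Module.finrank ℝ E), ‖iterDirDeriv (List.ofFn fun l ↦ (stdOrthonormalBasis ℝ E) (β l)) f y‖ₑ ^ 2) := by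
        rw [lintegral_const_mul' _ _ ENNReal.ofReal_ne_top,
          lintegral_comp_linear_eq M hM (g := fun y ↦ ∑ β : Fin i → Fin (Module.finrank ℝ E),
            ‖iterDirDeriv (List.ofFn fun l ↦ (stdOrthonormalBasis ℝ E) (β l)) f y‖ₑ ^ 2) hmeasS]
    _ = ENNReal.ofReal ((‖M‖ ^ 2) ^ i * d) *
          ∑ β : Fin i → Fin (Module.finrank ℝ E), ∫⁻ y, ‖iterDirDeriv (List.ofFn fun l ↦ (stdOrthonormalBasis ℝ E) (β l)) f y‖ₑ ^ 2 := by
        rw [← mul_assoc, ← ENNReal.ofReal_mul (by positivity),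
          lintegral_finsetSum _ fun β _ ↦ hmeas β]
    _ ≤ ENNReal.ofReal (max 1 (‖M‖ ^ 2) ^ j * d) *
          ∑ β : Fin i → Fin (Module.finrank ℝ E), ∫⁻ y, ‖iterDirDeriv (List.ofFn fun l ↦ (stdOrthonormalBasis ℝ E) (β l)) f y‖ₑ ^ 2 := by
        refine mul_le_mul' (ENNReal.ofReal_le_ofReal ?_) le_rfl
        refine mul_le_mul_of_nonneg_right ?_ (abs_nonneg _)
        calc (‖M‖ ^ 2) ^ i ≤ max 1 (‖M‖ ^ 2) ^ i :=
              pow_le_pow_left₀ (sq_nonneg _) (le_max_right _ _) i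
          _ ≤ max 1 (‖M‖ ^ 2) ^ j := pow_le_pow_right₀ (le_max_left _ _) hij

omit [InnerProductSpace ℝ F] [FiniteDimensional ℝ F] in
/-- **Translation invariance of the energies**: `E_j(f(· + v)) = E_j(f)`. [folklore] -/
theorem sobolevEnergy_comp_add_right [NormedSpace ℝ F] (j : ℕ) : ∀ (f : E → F) (v : E),
    sobolevEnergy j (fun x ↦ f (x + v)) = sobolevEnergy j f := by
  induction j with
  | zero =>
    intro f v
    simp only [sobolevEnergy_zero_left]
    exact lintegral_add_right_eq_self (μ := (volume : Measure E)) (fun x ↦ ‖f x‖ₑ ^ 2) v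
  | succ j ih =>
    intro f v
    rw [sobolevEnergy_succ, sobolevEnergy_succ,
      lintegral_add_right_eq_self (μ := (volume : Measure E)) (fun x ↦ ‖f x‖ₑ ^ 2) v]
    congr 1
    refine Finset.sum_congr rfl fun k _ ↦ ?_
    have h : (fun x ↦ fderiv ℝ (fun x ↦ f (x + v)) x (stdOrthonormalBasis ℝ E k)) =
        fun x ↦ (fun y ↦ fderiv ℝ f y (stdOrthonormalBasis ℝ E k)) (x + v) := by
      funext x
      rw [fderiv_comp_add_right]
    rw [h]
    exact ih (fun y ↦ fderiv ℝ f y (stdOrthonormalBasis ℝ E k)) v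

/-- **Energies under an invertible affine map** `y ↦ M y + v`:
`E_j(f(M · + v)) ≤ max(1, ‖M‖²)^j |det M|⁻¹ E_j(f)`. [cite: Adams1975, Thm. 3.35] -/
theorem sobolevEnergy_comp_affine_le (M : E →L[ℝ] E) (hM : LinearMap.det (M : E →ₗ[ℝ] E) ≠ 0)
    (v : E) (j : ℕ) {f : E → F} (hf : ContDiff ℝ ∞ f) :
    sobolevEnergy j (fun x ↦ f (M x + v)) ≤
      ENNReal.ofReal (max 1 (‖M‖ ^ 2) ^ j * |(LinearMap.det (M : E →ₗ[ℝ] E))⁻¹|) *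
        sobolevEnergy j f := by
  have h := sobolevEnergy_comp_linear_le M hM j (f := fun y ↦ f (y + v))
    (hf.comp (contDiff_id.add contDiff_const))
  rw [sobolevEnergy_comp_add_right j f v] at h
  exact h

end Linear

end Literature.Analysis.PDE

end
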